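import Literature.AlgebraicGeometry.ShimuraVarieties.UnitaryShimuraCurveEmbeddingPoints
import HarnessLib

/-!
# Injectivity of the sub-ball embedding `Sh_{K⋆}(U(J⋆), 𝔻)(ℂ) → Sh_K(U(H), 𝔹²)(ℂ)` — the coincidence WITNESS and the
# assembly spine of [Del71] Prop. 1.15 for `U(W^⊥) ↪ U(V)` (road (ii) leaf R2-1-inj, file (F-INJ), §§1–4)

Topic `AlgebraicGeometry/ShimuraVarieties`, namespace `…UnitaryCanonicalModel` (continuation of ★ (G4)
`UnitaryShimuraCurveEmbeddingPoints`).  THEOREMS ONLY (no definition, no instance, no named fact, no `sorry`; books 0).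
Cell `hodgecm-mathlib` (D-0151), road (ii) toward GS-3′ (A-p10 census §4), leaf R2-1-inj (census
`A-provers/A-p15/g7/CENSUS-R2-1-inj.A-p15g7.md`, A-plan2 dossier A.15 ADD.10; writers settled 2026-08-29T03:29:57Z:
(F-CPT) A-p09 `CompactCosetDepth`, (F-A) A-p02 `UnitaryGroupFrameStabiliser`, (F-INJ) this file).  HC_CM is proved only
modulo the 7 printed citations until rung 0 closes; nothing here is in a registered cone.

WHAT [Deligne1971TravauxShimura] Prop. 1.15 says (p. 132): for a sub-datum `G¹ ⊂ G²` and a compact open `K¹`, there is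
`K² ⊃ K¹` such that `_{K¹}M_ℂ(G¹,h¹) → _{K²}M_ℂ(G²,h²)` is a closed immersion — in particular INJECTIVE «pour `K²` assez petit»
(printed proof: Noetherian stationarity of the coincidence graph + injectivity at infinite level, Variante 1.15.1).  Here
`G¹ = Res U(J⋆)`, `G² = Res U(H)`, the inclusion is `u ↦ R_B(u ⊕ 1)` (★ `φGS`), and the map on `ℂ`-points is ★
`ShimuraSetGS.embPoints`, `[v, uK⋆] ↦ [𝔹(B^τ(v ⊕ 0)), φGS(u)K]`.  This file is the ASSEMBLY SPINE of the elementary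
(finiteness-and-depth) substitute for that proof:

* §1 `negConeToBall_eq_iff` — two negative vectors have the same ball point iff they are proportional; `U(H)(L⁺)` and
  `U(J⋆)(L⁺)` preserve the cones (`map_rational_mulVec_mem_negCone`, `ratToGLℂ_mulVec_mem_negCone`).
* §2 **the coincidence WITNESS** `ShimuraSetGS.embPoints_mk_eq_embPoints_mk_iff`:
  `embPoints [v, uK⋆] = embPoints [v′, u′K⋆]` iff some RATIONAL `γ ∈ U(H)(L⁺)` has `B^τ(v ⊕ 0) = c · γ^τ B^τ(v′ ⊕ 0)`
  (`c ∈ ℂˣ`) and `φGS(u)⁻¹ · γ_f · φGS(u′) ∈ K` (★ `ShimuraSet.mk_eq_mk_iff` read through ★ `ratToU21_smul_negConeToBall`).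
* §3 **a witness in the image of `embRational` closes the coincidence in `Sh_{K⋆}`** (`mk_eq_mk_of_embRational_witness`),
  granted the TRACE condition `K.comap φGS ≤ K⋆` ([Del71] 1.15's `K² ∩ G¹(𝔸_f) = K¹`, supplied by A-p10's ★ R2-1-top
  `CompactOpenSubgroupTrace` or automatic for the cofinal pairs `(φGS⁻¹K, K)`): ★ `map_embRational_mulVec_frameEmbNeg`,
  ★ `rationalToFinAdelic_embRational_eq_φGS`, ★ `frameEmb_injective`, ★ `ShimuraSetGS.mk_eq_mk_iff`.
* §4 **the spine** `ShimuraSetGS.embPoints_injective_of_witnesses`: injectivity follows from the trace condition and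
  two properties of coincidence witnesses — (hA) a witness mapping `B(L² ⊕ 0) = W^⊥` into itself is `B(γ⋆ ⊕ᶠ 1)B⁻¹ =
  embRational γ⋆` (the census's case (A); at `B`-adapted principal depth `3 ∣ 𝔫` this is (F-A)'s head — the centre part
  `z(ζ)` dies by Kronecker–Minkowski ★ `UnitaryGroupLevelDet.eq_one_of_forall_norm_eq_one_of_eq_one_add_mul`), and (hB)
  EVERY witness maps `W^⊥` into itself (the census's case (B): at depth `≤ 𝔫₁` no CM self-intersection of the immersed
  special curve survives — finiteness ★ `UnitaryBallSpecialCycleFinite.finite_specialBall_translates_submodule` + ★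
  `UnitaryBallDiscontinuity.finite_setOf_smul_mem` + depth ★ (F-CPT) `CompactCosetDepth`; §§5–7 of this leaf, next
  edition).  Both enter §4 as HYPOTHESES, so the spine is unconditional and each supplier lands independently.

References: [Deligne1971TravauxShimura] Prop. 1.15 + proof pp. 132–133; [Milne2005ShimuraVarieties] §5 (5.1) p. 56,
Lemma 5.13 p. 57, Thm. 5.16; [Liu2021] Thm. 4.15 proof (FJcycle.tex l. 2193–2208); [Kudla1984] §1.
-/

noncomputable section

open Function MulAction Matrix NumberField IsDedekindDomain
open scoped Matrix ComplexOrder Pointwise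
open Literature.Geometry.ComplexHyperbolic Literature.Geometry.ComplexHyperbolic.BallModel
open Literature.NumberTheory.Automorphic Literature.NumberTheory.Automorphic.UnitaryGroup

namespace Literature.AlgebraicGeometry.ShimuraVarieties

namespace UnitaryCanonicalModel

variable {L : Type} [Field L] [NumberField L] [IsCMField L] {H : Matrix (Fin 3) (Fin 3) L} {τ : L →+* ℂ} {T : GL (Fin 3) ℂ}

/-! ### §1. Ball points of negative vectors: equality iff proportionality; rational elements preserve the cones -/

omit [NumberField L] [IsCMField L] in
/-- `T (T⁻¹ v) = v`. [folklore] -/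
private theorem mulVec_inv_mulVec'' (T : GL (Fin 3) ℂ) (v : Fin 3 → ℂ) :
    (T : Matrix (Fin 3) (Fin 3) ℂ) *ᵥ (((T⁻¹ : GL (Fin 3) ℂ) : Matrix (Fin 3) (Fin 3) ℂ) *ᵥ v) = v := by
  rw [mulVec_mulVec, ← Units.val_mul, mul_inv_cancel, Units.val_one, one_mulVec]

omit [NumberField L] [IsCMField L] in
/-- **Two negative vectors have the same ball point iff they are proportional**: `𝔹(v) = 𝔹(w) ↔ ∃ c ∈ ℂˣ, v = c·w`
(`𝔹 = proj ∘ T⁻¹`, ★ `eq_smul_of_proj_eq` / `negConeToBall_smul`). [cite: BergeronMillsonMoeglin2016Balls, Part 2 §1.3]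
[cite: Milne2005ShimuraVarieties, Def. 12.5 p. 113] -/
theorem negConeToBall_eq_iff (hT : formCongr (starRingEnd ℂ) T (H.map τ) = BallModel.J) {v w : Fin 3 → ℂ}
    (hv : v ∈ negCone (H.map τ)) (hw : w ∈ negCone (H.map τ)) :
    negConeToBall hT hv = negConeToBall hT hw ↔ ∃ c : ℂ, c ≠ 0 ∧ v = c • w := by
  constructor
  · intro h
    have hprop := UnitaryBallUniformisationDatum.eq_smul_of_proj_eq (Q_inv_mulVec_neg_of_mem_negCone hT hv)
      (Q_inv_mulVec_neg_of_mem_negCone hT hw) h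
    refine ⟨(((T⁻¹ : GL (Fin 3) ℂ) : Matrix (Fin 3) (Fin 3) ℂ) *ᵥ v) 2 /
        (((T⁻¹ : GL (Fin 3) ℂ) : Matrix (Fin 3) (Fin 3) ℂ) *ᵥ w) 2,
      div_ne_zero (apply_two_ne_zero_of_mem_negCone hT hv) (apply_two_ne_zero_of_mem_negCone hT hw), ?_⟩
    have h' := congrArg (fun x => (T : Matrix (Fin 3) (Fin 3) ℂ) *ᵥ x) hprop
    simp only [mulVec_inv_mulVec'', mulVec_smul] at h'
    exact h'
  · rintro ⟨c, hc, rfl⟩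
    exact negConeToBall_smul hT hc hw hv

/-- **`U(H)(L⁺)` preserves the negative cone of `H^τ`**: `γ^τ w` is negative when `w` is (`(γ^τ)ᴴ H^τ γ^τ = H^τ`, ★
`conjTranspose_map_mul_map_of_mem_rational`). [cite: BergeronMillsonMoeglin2016Balls, Part 2 §1.3] -/
theorem map_rational_mulVec_mem_negCone (γ : rational (↥(maximalRealSubfield L)) L (IsCMField.complexConj L) 3 H)
    {w : Fin 3 → ℂ} (hw : w ∈ negCone (H.map τ)) :
    ((Matrix.GeneralLinearGroup.map τ (γ : GL (Fin 3) L) : GL (Fin 3) ℂ) : Matrix (Fin 3) (Fin 3) ℂ) *ᵥ w ∈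
      negCone (H.map τ) := by
  have hu := conjTranspose_map_mul_map_of_mem_rational L H τ γ.2
  have hcoe : ((Matrix.GeneralLinearGroup.map τ (γ : GL (Fin 3) L) : GL (Fin 3) ℂ) : Matrix (Fin 3) (Fin 3) ℂ) =
      ((γ : GL (Fin 3) L) : Matrix (Fin 3) (Fin 3) L).map τ := rfl
  rw [hcoe, mem_negCone_iff, star_mulVec, mulVec_mulVec, dotProduct_mulVec, vecMul_vecMul, ← Matrix.mul_assoc, hu,
    ← dotProduct_mulVec]
  exact mem_negCone_iff.1 hw

/-- **`U(J⋆)(L⁺)` preserves the negative cone of `J⋆^τ`** (★ `smul_ratToGLℂ_mulVec_mem_negCone` at `c = 1`).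
[cite: BergeronMillsonMoeglin2016Balls, Part 2 §1.3] -/
theorem ratToGLℂ_mulVec_mem_negCone {Jstar : Matrix (Fin 2) (Fin 2) L}
    (γ : ↥(rational (↥(maximalRealSubfield L)) L (IsCMField.complexConj L) 2 Jstar)) {v : Fin 2 → ℂ}
    (hv : v ∈ negCone (Jstar.map τ)) :
    ((ratToGLℂ L Jstar τ γ : GL (Fin 2) ℂ) : Matrix (Fin 2) (Fin 2) ℂ) *ᵥ v ∈ negCone (Jstar.map τ) := by
  simpa only [one_smul] using smul_ratToGLℂ_mulVec_mem_negCone L Jstar τ γ one_ne_zero hv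

omit [NumberField L] [IsCMField L] in
/-- `B^τ((c·v) ⊕ 0) = c · B^τ(v ⊕ 0)` (linearity of the frame embedding `x ↦ B(x ⊕ 0)`). [cite: Kudla1984, §1] -/
theorem frameEmbNeg_smul' (B : GL (Fin 3) L) (c : ℂ) (v : Fin 2 → ℂ) :
    frameEmbNeg τ B (c • v) = c • frameEmbNeg τ B v := by
  unfold frameEmbNeg
  have h : Fin.append (c • v) (0 : Fin 1 → ℂ) = c • Fin.append v (0 : Fin 1 → ℂ) := by
    ext i
    refine Fin.addCases (fun j => ?_) (fun j => ?_) i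
    · simp only [Fin.append_left, Pi.smul_apply]
    · simp only [Fin.append_right, Pi.smul_apply, Pi.zero_apply, smul_zero]
  rw [h, mulVec_smul]

omit [NumberField L] [IsCMField L] in
/-- **`v ↦ B^τ(v ⊕ 0)` is injective** (★ `frameEmb_injective` for the frame `B^τ`). [cite: Kudla1984, §1] -/
theorem frameEmbNeg_injective (B : GL (Fin 3) L) : Function.Injective (frameEmbNeg τ B) := by
  intro v v' h
  have hcoe : (B : Matrix (Fin 3) (Fin 3) L).map τ =
      ((Matrix.GeneralLinearGroup.map τ (show GL (Fin (2 + 1)) L from B) : GL (Fin (2 + 1)) ℂ) :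
        Matrix (Fin (2 + 1)) (Fin (2 + 1)) ℂ) := rfl
  unfold frameEmbNeg at h
  rw [hcoe] at h
  exact frameEmb_injective (N₁ := 2) (N₂ := 1) (Matrix.GeneralLinearGroup.map τ (show GL (Fin (2 + 1)) L from B)) h

/-! ### §2. The coincidence WITNESS -/

section Witness

variable (L H τ T) (hT : formCongr (starRingEnd ℂ) T (H.map τ) = BallModel.J)
  (Jstar : Matrix (Fin 2) (Fin 2) L) (Jperp : Matrix (Fin 1) (Fin 1) L) (B : GL (Fin 3) L) {a : L} (ha : a ≠ 0)
  (hB : formCongr ((IsCMField.complexConj L : L ≃ₐ[↥(maximalRealSubfield L)] L) : L →+* L) B (a • H) =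
    finSum 2 1 Jstar Jperp)
  (hτa : 0 < (τ a).re) (hτa' : (τ a).im = 0)
  (Kstar : Subgroup ↥(finAdelic (↥(maximalRealSubfield L)) L (IsCMField.complexConj L) 2 Jstar))
  (K : Subgroup ↥(finAdelic (↥(maximalRealSubfield L)) L (IsCMField.complexConj L) 3 H))
  (hK : Kstar.map (φGS L Jstar Jperp H B ha hB) ≤ K)

/-- **The coincidence witness** ([Del71] 1.15's relation `u(x) = u(y)` read on `ℂ`-points): two classes of the curve's Shimura
set have the same image in `Sh_K(U(H), 𝔹²)(ℂ)` iff some RATIONAL `γ ∈ U(H)(L⁺)` carries one sub-ball vector to a multiple of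
the other, `B^τ(v ⊕ 0) = c · γ^τ B^τ(v′ ⊕ 0)`, and matches the cosets, `φGS(u)⁻¹ · γ_f · φGS(u′) ∈ K` («`G(ℚ)` acts on the left,
`K` on the right»). [cite: Deligne1971TravauxShimura, Prop. 1.15 proof p. 132] [cite: Milne2005ShimuraVarieties, §5 (5.1) p. 56 and Lemma 5.13 p. 57] -/
theorem ShimuraSetGS.embPoints_mk_eq_embPoints_mk_iff (v v' : Fin 2 → ℂ) (hv : v ∈ negCone (Jstar.map τ))
    (hv' : v' ∈ negCone (Jstar.map τ)) (u u' : ↥(finAdelic (↥(maximalRealSubfield L)) L (IsCMField.complexConj L) 2 Jstar)) :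
    ShimuraSetGS.embPoints L H τ T hT Jstar Jperp B ha hB hτa hτa' Kstar K hK (ShimuraSetGS.mk L Jstar τ Kstar v hv u) =
        ShimuraSetGS.embPoints L H τ T hT Jstar Jperp B ha hB hτa hτa' Kstar K hK (ShimuraSetGS.mk L Jstar τ Kstar v' hv' u') ↔
      ∃ γ : rational (↥(maximalRealSubfield L)) L (IsCMField.complexConj L) 3 H,
        (∃ c : ℂ, c ≠ 0 ∧ frameEmbNeg τ B v =
          c • (((Matrix.GeneralLinearGroup.map τ (γ : GL (Fin 3) L) : GL (Fin 3) ℂ) : Matrix (Fin 3) (Fin 3) ℂ) *ᵥ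
            frameEmbNeg τ B v')) ∧
        ((φGS L Jstar Jperp H B ha hB u)⁻¹ *
            (rationalToFinAdelic (↥(maximalRealSubfield L)) L (IsCMField.complexConj L) 3 H γ * φGS L Jstar Jperp H B ha hB u') :
          finAdelic (↥(maximalRealSubfield L)) L (IsCMField.complexConj L) 3 H) ∈ K := by
  rw [ShimuraSetGS.embPoints_mk, ShimuraSetGS.embPoints_mk, ShimuraSet.mk_eq_mk_iff]
  refine exists_congr fun γ => ?_
  rw [ratToU21_smul_negConeToBall hT γ (frameEmbNeg_mem_negCone τ hB hτa hτa' hv')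
      (map_rational_mulVec_mem_negCone γ (frameEmbNeg_mem_negCone τ hB hτa hτa' hv')),
    eq_comm, negConeToBall_eq_iff]

/-! ### §3. A witness in the image of `embRational` closes the coincidence in `Sh_{K⋆}` -/

/-- **Case (A) closer**: if the witness is `embRational γ⋆ = B(γ⋆ ⊕ᶠ 1)B⁻¹` for a rational `γ⋆ ∈ U(J⋆)(L⁺)`, and the trace
condition `K ∩ im φGS ⊆ φGS(K⋆)` holds (`K.comap φGS ≤ K⋆`; [Del71] 1.15's `K² ∩ G¹(𝔸_f) = K¹`), then the two classes are
ALREADY equal in `Sh_{K⋆}(U(J⋆), 𝔻)(ℂ)`: `γ⋆^τ v′ ∝ v` by ★ `map_embRational_mulVec_frameEmbNeg` + injectivity of `v ↦ B^τ(v ⊕ 0)`,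
and `u⁻¹ γ⋆_f u′ ∈ K⋆` by ★ `rationalToFinAdelic_embRational_eq_φGS`.
[cite: Deligne1971TravauxShimura, Prop. 1.15 and Lemme 1.15.3 p. 133] [cite: Milne2005ShimuraVarieties, Lemma 5.13 p. 57] -/
theorem ShimuraSetGS.mk_eq_mk_of_embRational_witness (hKc : K.comap (φGS L Jstar Jperp H B ha hB) ≤ Kstar)
    {v v' : Fin 2 → ℂ} (hv : v ∈ negCone (Jstar.map τ)) (hv' : v' ∈ negCone (Jstar.map τ))
    {u u' : ↥(finAdelic (↥(maximalRealSubfield L)) L (IsCMField.complexConj L) 2 Jstar)}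
    (γs : ↥(rational (↥(maximalRealSubfield L)) L (IsCMField.complexConj L) 2 Jstar)) {c : ℂ} (hc : c ≠ 0)
    (hball : frameEmbNeg τ B v =
      c • (((Matrix.GeneralLinearGroup.map τ
        ((embRational (↥(maximalRealSubfield L)) L (IsCMField.complexConj L) 2 1 Jstar Jperp H B ha hB γs : rational
          (↥(maximalRealSubfield L)) L (IsCMField.complexConj L) 3 H) : GL (Fin 3) L) : GL (Fin 3) ℂ) :
            Matrix (Fin 3) (Fin 3) ℂ) *ᵥ frameEmbNeg τ B v'))
    (hcoset : ((φGS L Jstar Jperp H B ha hB u)⁻¹ *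
        (rationalToFinAdelic (↥(maximalRealSubfield L)) L (IsCMField.complexConj L) 3 H
            (embRational (↥(maximalRealSubfield L)) L (IsCMField.complexConj L) 2 1 Jstar Jperp H B ha hB γs) *
          φGS L Jstar Jperp H B ha hB u') : finAdelic (↥(maximalRealSubfield L)) L (IsCMField.complexConj L) 3 H) ∈ K) :
    ShimuraSetGS.mk L Jstar τ Kstar v hv u = ShimuraSetGS.mk L Jstar τ Kstar v' hv' u' := by
  rw [ShimuraSetGS.mk_eq_mk_iff]
  refine ⟨γs, c, hc, ?_, ?_⟩
  · -- ball: `B^τ(v ⊕ 0) = c · B^τ(γ⋆^τ v′ ⊕ 0) = B^τ((c · γ⋆^τ v′) ⊕ 0)`, and `v ↦ B^τ(v ⊕ 0)` is injective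
    rw [map_embRational_mulVec_frameEmbNeg, ← frameEmbNeg_smul'] at hball
    exact (frameEmbNeg_injective B hball).symm
  · -- coset: `φ(u)⁻¹ φ(γ⋆_f) φ(u′) = φ(u⁻¹ γ⋆_f u′) ∈ K`, so `u⁻¹ γ⋆_f u′ ∈ K.comap φ ≤ K⋆`
    rw [rationalToFinAdelic_embRational_eq_φGS] at hcoset
    have hmem : u⁻¹ * (rationalToFinAdelic (↥(maximalRealSubfield L)) L (IsCMField.complexConj L) 2 Jstar γs * u') ∈
        Kstar := by
      apply hKc
      rw [Subgroup.mem_comap, map_mul, map_mul, map_inv]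
      exact hcoset
    rw [MulAction.Quotient.smul_coe, eq_comm, QuotientGroup.eq]
    exact hmem

/-! ### §4. The assembly spine: injectivity from the two witness properties -/

/-- **The spine of [Del71] Prop. 1.15 for `U(W^⊥) ↪ U(V)`**.  Suppose the trace condition `K.comap φGS ≤ K⋆` and, for every
coincidence WITNESS `γ ∈ U(H)(L⁺)` (i.e. `B^τ(v ⊕ 0) = c·γ^τ B^τ(v′ ⊕ 0)` for some negative `v, v′` and `φGS(u)⁻¹ γ_f φGS(u′) ∈ K`):
(`hcaseB`) `γ` maps the rational sub-space `B(L² ⊕ 0) = W^⊥` into itself (no CM self-intersection survives at this level — census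
case (B)), and (`hcaseA`) a witness mapping `B(L² ⊕ 0)` into itself is `embRational γ⋆` (census case (A): stabiliser = block
diagonal, centre part killed at `B`-adapted principal depth `3 ∣ 𝔫`).  Then `embPoints : Sh_{K⋆}(U(J⋆),𝔻)(ℂ) → Sh_K(U(H),𝔹²)(ℂ)`
is INJECTIVE.  (`hcaseA`) is (F-A) `UnitaryGroupFrameStabiliser`'s head and (`hcaseB`) the finiteness-and-depth theorem of §§5–7, both at
deep enough `K`; here they are hypotheses, so the spine is unconditional.
[cite: Deligne1971TravauxShimura, Prop. 1.15 + proof pp. 132–133] [cite: Milne2005ShimuraVarieties, Thm. 5.16 and Lemma 5.13 p. 57] -/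
theorem ShimuraSetGS.embPoints_injective_of_witnesses (hKc : K.comap (φGS L Jstar Jperp H B ha hB) ≤ Kstar)
    (hcaseB : ∀ (γ : rational (↥(maximalRealSubfield L)) L (IsCMField.complexConj L) 3 H) (v v' : Fin 2 → ℂ),
      v ∈ negCone (Jstar.map τ) → v' ∈ negCone (Jstar.map τ) →
      ∀ u u' : ↥(finAdelic (↥(maximalRealSubfield L)) L (IsCMField.complexConj L) 2 Jstar),
      (∃ c : ℂ, c ≠ 0 ∧ frameEmbNeg τ B v =
          c • (((Matrix.GeneralLinearGroup.map τ (γ : GL (Fin 3) L) : GL (Fin 3) ℂ) : Matrix (Fin 3) (Fin 3) ℂ) *ᵥ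
            frameEmbNeg τ B v')) →
      ((φGS L Jstar Jperp H B ha hB u)⁻¹ *
            (rationalToFinAdelic (↥(maximalRealSubfield L)) L (IsCMField.complexConj L) 3 H γ * φGS L Jstar Jperp H B ha hB u') :
          finAdelic (↥(maximalRealSubfield L)) L (IsCMField.complexConj L) 3 H) ∈ K →
      ∀ x : Fin 2 → L, ∃ y : Fin 2 → L,
        ((γ : GL (Fin 3) L) : Matrix (Fin 3) (Fin 3) L) *ᵥ ((B : Matrix (Fin 3) (Fin 3) L) *ᵥ Fin.append x (0 : Fin 1 → L)) =
          (B : Matrix (Fin 3) (Fin 3) L) *ᵥ Fin.append y (0 : Fin 1 → L))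
    (hcaseA : ∀ (γ : rational (↥(maximalRealSubfield L)) L (IsCMField.complexConj L) 3 H)
      (u u' : ↥(finAdelic (↥(maximalRealSubfield L)) L (IsCMField.complexConj L) 2 Jstar)),
      (∀ x : Fin 2 → L, ∃ y : Fin 2 → L,
        ((γ : GL (Fin 3) L) : Matrix (Fin 3) (Fin 3) L) *ᵥ ((B : Matrix (Fin 3) (Fin 3) L) *ᵥ Fin.append x (0 : Fin 1 → L)) =
          (B : Matrix (Fin 3) (Fin 3) L) *ᵥ Fin.append y (0 : Fin 1 → L)) →
      ((φGS L Jstar Jperp H B ha hB u)⁻¹ *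
            (rationalToFinAdelic (↥(maximalRealSubfield L)) L (IsCMField.complexConj L) 3 H γ * φGS L Jstar Jperp H B ha hB u') :
          finAdelic (↥(maximalRealSubfield L)) L (IsCMField.complexConj L) 3 H) ∈ K →
      ∃ γs : ↥(rational (↥(maximalRealSubfield L)) L (IsCMField.complexConj L) 2 Jstar),
        γ = embRational (↥(maximalRealSubfield L)) L (IsCMField.complexConj L) 2 1 Jstar Jperp H B ha hB γs) :
    Function.Injective (ShimuraSetGS.embPoints L H τ T hT Jstar Jperp B ha hB hτa hτa' Kstar K hK) := by
  intro P Q hPQ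
  obtain ⟨v, hv, u, rfl⟩ := ShimuraSetGS.mk_surjective L Jstar τ Kstar P
  obtain ⟨v', hv', u', rfl⟩ := ShimuraSetGS.mk_surjective L Jstar τ Kstar Q
  obtain ⟨γ, hball, hcoset⟩ :=
    (ShimuraSetGS.embPoints_mk_eq_embPoints_mk_iff L H τ T hT Jstar Jperp B ha hB hτa hτa' Kstar K hK v v' hv hv' u u').1 hPQ
  obtain ⟨γs, rfl⟩ := hcaseA γ u u' (hcaseB γ v v' hv hv' u u' hball hcoset) hcoset
  obtain ⟨c, hc, hballc⟩ := hball
  exact ShimuraSetGS.mk_eq_mk_of_embRational_witness L H τ Jstar Jperp B ha hB Kstar K hKc hv hv' γs hc hballc hcoset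

/-! ### §5. Rational elements whose finite-adelic image lies in `im φGS` stabilise `B(L² ⊕ 0) = W^⊥` -/

/-- The matrix of `φGS(u)` over the finite adeles: `B_f · (u ⊕ᶠ 1) · B_f⁻¹`. [cite: Liu2021, Thm. 4.15 proof (FJcycle.tex l. 2193–2203)]
[cite: PlatonovRapinchuk1994, §5.1] -/
theorem coe_φGS_eq (u : ↥(finAdelic (↥(maximalRealSubfield L)) L (IsCMField.complexConj L) 2 Jstar)) :
    (((φGS L Jstar Jperp H B ha hB u : ↥(finAdelic (↥(maximalRealSubfield L)) L (IsCMField.complexConj L) 3 H)) :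
        GL (Fin 3) (FiniteAdeleRing (𝓞 L) L)) : Matrix (Fin 3) (Fin 3) (FiniteAdeleRing (𝓞 L) L)) =
      (B : Matrix (Fin 3) (Fin 3) L).map (algebraMap L (FiniteAdeleRing (𝓞 L) L)) *
        finSum 2 1 (((u : ↥(finAdelic (↥(maximalRealSubfield L)) L (IsCMField.complexConj L) 2 Jstar)) :
            GL (Fin 2) (FiniteAdeleRing (𝓞 L) L)) : Matrix (Fin 2) (Fin 2) (FiniteAdeleRing (𝓞 L) L))
          (1 : Matrix (Fin 1) (Fin 1) (FiniteAdeleRing (𝓞 L) L)) *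
        ((B⁻¹ : GL (Fin 3) L) : Matrix (Fin 3) (Fin 3) L).map (algebraMap L (FiniteAdeleRing (𝓞 L) L)) := by
  rw [φGS_apply, coe_finAdelicCongr_apply, ← map_inv, Units.val_mul, Units.val_mul]
  have h1 : (((finAdelicBlockDiag (↥(maximalRealSubfield L)) L (IsCMField.complexConj L) 2 1 Jstar Jperp (u, 1) :
      ↥(finAdelic (↥(maximalRealSubfield L)) L (IsCMField.complexConj L) (2 + 1) (finSum 2 1 Jstar Jperp))) :
        GL (Fin (2 + 1)) (FiniteAdeleRing (𝓞 L) L)) : Matrix (Fin (2 + 1)) (Fin (2 + 1)) (FiniteAdeleRing (𝓞 L) L)) =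
      finSum 2 1 (((u : ↥(finAdelic (↥(maximalRealSubfield L)) L (IsCMField.complexConj L) 2 Jstar)) :
          GL (Fin 2) (FiniteAdeleRing (𝓞 L) L)) : Matrix (Fin 2) (Fin 2) (FiniteAdeleRing (𝓞 L) L))
        (1 : Matrix (Fin 1) (Fin 1) (FiniteAdeleRing (𝓞 L) L)) := by
    rw [coe_finAdelicBlockDiag, coe_reindexGL]
    change Matrix.reindex finSumFinEquiv finSumFinEquiv (Matrix.fromBlocks _ 0 0
      (((1 : ↥(finAdelic (↥(maximalRealSubfield L)) L (IsCMField.complexConj L) 1 Jperp)) :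
        GL (Fin 1) (FiniteAdeleRing (𝓞 L) L)) : Matrix (Fin 1) (Fin 1) (FiniteAdeleRing (𝓞 L) L))) = _
    rw [OneMemClass.coe_one, Units.val_one]
    rfl
  rw [h1]
  rfl

/-- **A RATIONAL element of `U(H)(L⁺)` whose finite-adelic image lies in `φGS(U(J⋆)(𝔸_f))` maps `B(L² ⊕ 0) = W^⊥` into itself**
(its `B`-conjugate is block diagonal over `𝔸_{L,f}`, hence — being rational — over `L`: the last coordinate of
`B⁻¹γB(x ⊕ 0)` vanishes in `𝔸_{L,f}`, so in `L`).  This is why the limit set `A·C ⊆ im φGS` of the depth argument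
contains no «bad» witness. [cite: Deligne1971TravauxShimura, Lemme 1.15.3 p. 133] [cite: PlatonovRapinchuk1994, §5.1] -/
theorem mapsTo_frame_of_rationalToFinAdelic_mem_range (γ : rational (↥(maximalRealSubfield L)) L (IsCMField.complexConj L) 3 H)
    (hγ : rationalToFinAdelic (↥(maximalRealSubfield L)) L (IsCMField.complexConj L) 3 H γ ∈ (φGS L Jstar Jperp H B ha hB).range)
    (x : Fin 2 → L) :
    ∃ y : Fin 2 → L,
      ((γ : GL (Fin 3) L) : Matrix (Fin 3) (Fin 3) L) *ᵥ ((B : Matrix (Fin 3) (Fin 3) L) *ᵥ Fin.append x (0 : Fin 1 → L)) =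
        (B : Matrix (Fin 3) (Fin 3) L) *ᵥ Fin.append y (0 : Fin 1 → L) := by
  obtain ⟨u, hu⟩ := hγ
  set ι𝔸 := algebraMap L (FiniteAdeleRing (𝓞 L) L) with hι𝔸
  -- the rational vector `w := B⁻¹ γ B (x ⊕ 0)` and its two blocks
  set w : Fin (2 + 1) → L := ((B⁻¹ : GL (Fin 3) L) : Matrix (Fin 3) (Fin 3) L) *ᵥ
    (((γ : GL (Fin 3) L) : Matrix (Fin 3) (Fin 3) L) *ᵥ ((B : Matrix (Fin 3) (Fin 3) L) *ᵥ Fin.append x (0 : Fin 1 → L)))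
    with hw
  refine ⟨fun i => w (Fin.castAdd 1 i), ?_⟩
  -- it suffices that the last block of `w` vanishes
  suffices hlast : ∀ j : Fin 1, w (Fin.natAdd 2 j) = 0 by
    have hwapp : w = Fin.append (fun i => w (Fin.castAdd 1 i)) (0 : Fin 1 → L) := by
      funext k
      induction k using Fin.addCases with
      | left i => rw [Fin.append_left]
      | right j => rw [Fin.append_right, hlast j]; rfl
    have hBw : (B : Matrix (Fin 3) (Fin 3) L) *ᵥ w =
        ((γ : GL (Fin 3) L) : Matrix (Fin 3) (Fin 3) L) *ᵥ ((B : Matrix (Fin 3) (Fin 3) L) *ᵥ Fin.append x (0 : Fin 1 → L)) := by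
      rw [hw, mulVec_mulVec, ← Units.val_mul, mul_inv_cancel, Units.val_one, one_mulVec]
    rw [← hBw]
    exact congrArg ((B : Matrix (Fin 3) (Fin 3) L).mulVec) hwapp
  -- read `w` over the finite adeles: `w_𝔸 = (u ⊕ᶠ 1)·(x_𝔸 ⊕ 0)`, whose last block is `1 · 0 = 0`
  intro j
  have hγ𝔸 : ((γ : GL (Fin 3) L) : Matrix (Fin 3) (Fin 3) L).map ι𝔸 =
      (B : Matrix (Fin 3) (Fin 3) L).map ι𝔸 *
        finSum 2 1 (((u : ↥(finAdelic (↥(maximalRealSubfield L)) L (IsCMField.complexConj L) 2 Jstar)) :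
            GL (Fin 2) (FiniteAdeleRing (𝓞 L) L)) : Matrix (Fin 2) (Fin 2) (FiniteAdeleRing (𝓞 L) L)) 1 *
        ((B⁻¹ : GL (Fin 3) L) : Matrix (Fin 3) (Fin 3) L).map ι𝔸 := by
    rw [← coe_φGS_eq L H Jstar Jperp B ha hB u, hu, coe_rationalToFinAdelic]
    rfl
  have hBinv : ((B⁻¹ : GL (Fin 3) L) : Matrix (Fin 3) (Fin 3) L).map ι𝔸 * (B : Matrix (Fin 3) (Fin 3) L).map ι𝔸 = 1 := by
    rw [← Matrix.map_mul, ← Units.val_mul, inv_mul_cancel, Units.val_one, Matrix.map_one _ (map_zero ι𝔸) (map_one ι𝔸)]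
  have hw𝔸 : ι𝔸 ∘ w =
      finSum 2 1 (((u : ↥(finAdelic (↥(maximalRealSubfield L)) L (IsCMField.complexConj L) 2 Jstar)) :
            GL (Fin 2) (FiniteAdeleRing (𝓞 L) L)) : Matrix (Fin 2) (Fin 2) (FiniteAdeleRing (𝓞 L) L)) 1 *ᵥ
        Fin.append (ι𝔸 ∘ x) (0 : Fin 1 → FiniteAdeleRing (𝓞 L) L) := by
    have happ : ι𝔸 ∘ Fin.append x (0 : Fin 1 → L) = Fin.append (ι𝔸 ∘ x) (0 : Fin 1 → FiniteAdeleRing (𝓞 L) L) := by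
      funext k
      induction k using Fin.addCases with
      | left i => simp only [Function.comp_apply, Fin.append_left]
      | right j => simp only [Function.comp_apply, Fin.append_right, Pi.zero_apply, map_zero]
    have hmv : ∀ (M : Matrix (Fin 3) (Fin 3) L) (v : Fin 3 → L), ι𝔸 ∘ (M *ᵥ v) = M.map ι𝔸 *ᵥ (ι𝔸 ∘ v) :=
      fun M v => funext fun i => RingHom.map_mulVec ι𝔸 M v i
    have hmat : ((B⁻¹ : GL (Fin 3) L) : Matrix (Fin 3) (Fin 3) L).map ι𝔸 *
        ((B : Matrix (Fin 3) (Fin 3) L).map ι𝔸 *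
          finSum 2 1 (((u : ↥(finAdelic (↥(maximalRealSubfield L)) L (IsCMField.complexConj L) 2 Jstar)) :
              GL (Fin 2) (FiniteAdeleRing (𝓞 L) L)) : Matrix (Fin 2) (Fin 2) (FiniteAdeleRing (𝓞 L) L)) 1 *
          ((B⁻¹ : GL (Fin 3) L) : Matrix (Fin 3) (Fin 3) L).map ι𝔸) * (B : Matrix (Fin 3) (Fin 3) L).map ι𝔸 =
        finSum 2 1 (((u : ↥(finAdelic (↥(maximalRealSubfield L)) L (IsCMField.complexConj L) 2 Jstar)) :
            GL (Fin 2) (FiniteAdeleRing (𝓞 L) L)) : Matrix (Fin 2) (Fin 2) (FiniteAdeleRing (𝓞 L) L)) 1 := by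
      calc _ = (((B⁻¹ : GL (Fin 3) L) : Matrix (Fin 3) (Fin 3) L).map ι𝔸 * (B : Matrix (Fin 3) (Fin 3) L).map ι𝔸) *
            finSum 2 1 (((u : ↥(finAdelic (↥(maximalRealSubfield L)) L (IsCMField.complexConj L) 2 Jstar)) :
                GL (Fin 2) (FiniteAdeleRing (𝓞 L) L)) : Matrix (Fin 2) (Fin 2) (FiniteAdeleRing (𝓞 L) L)) 1 *
            (((B⁻¹ : GL (Fin 3) L) : Matrix (Fin 3) (Fin 3) L).map ι𝔸 * (B : Matrix (Fin 3) (Fin 3) L).map ι𝔸) := by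
            simp only [Matrix.mul_assoc]
        _ = _ := by rw [hBinv, Matrix.one_mul, Matrix.mul_one]
    rw [hw, hmv, hmv, hmv, hγ𝔸, happ, mulVec_mulVec, mulVec_mulVec, hmat]
  have hj := congrFun hw𝔸 (Fin.natAdd 2 j)
  rw [Function.comp_apply, finSum_mulVec_append, Fin.append_right, one_mulVec, Pi.zero_apply] at hj
  -- `L → 𝔸_{L,f}` is injective (read at one finite place)
  have hinj : Function.Injective ι𝔸 := by
    obtain ⟨P, hP⟩ := Ideal.exists_maximal (𝓞 L)
    let v : IsDedekindDomain.HeightOneSpectrum (𝓞 L) :=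
      ⟨P, hP.isPrime, Ring.ne_bot_of_isMaximal_of_not_isField hP (RingOfIntegers.not_isField L)⟩
    intro a b hab
    have h := congrArg (fun z : FiniteAdeleRing (𝓞 L) L => z v) hab
    simp only [hι𝔸, FiniteAdeleRing.algebraMap_apply] at h
    exact (algebraMap L (v.adicCompletion L)).injective h
  exact (map_eq_zero_iff ι𝔸 hinj).1 hj

end Witness

end UnitaryCanonicalModel

end Literature.AlgebraicGeometry.ShimuraVarieties

end
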